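import Summits.BirchSwinnertonDyer.Rank1Residual.Additive.LocalTowerKernelAtPTwistedOrdinary
import Summits.BirchSwinnertonDyer.Rank1Residual.Additive.GoodModelKernelRationalPoints
import Summits.BirchSwinnertonDyer.Rank1Residual.Iwasawa.GoodReductionFixedPointsTorsion
import Summits.BirchSwinnertonDyer.Rank1Residual.X2.GreenbergVatsalReductionDatum
import Literature.NumberTheory.EllipticCurves.Greenberg1999.KummerImageGoodOrdinaryModel
import Literature.NumberTheory.EllipticCurves.OrdinaryLocalReductionMapProofs
import Literature.NumberTheory.EllipticCurves.SelmerCorankControlRatOrdinaryProofs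
import Literature.NumberTheory.EllipticCurves.GaloisConjugateReductionLayerProofs
import Literature.NumberTheory.EllipticCurves.HasseWeilGoodReductionFrobeniusProofs
import Literature.NumberTheory.EllipticCurves.LFunctionPrimeCoeff
import HarnessLib

/-!
# Greenberg's Lemma 3.4 at `n = 0` in its VANISHING case: at a GOOD ORDINARY NON-ANOMALOUS `v ∣ p`
# the level-`0` local tower kernel has no `p`-power torsion, `W.localTowerKerPrimary κ ℚ_v 0 = ⊥`
# (team n1011, ROW T-GR34NA, seat p06 GEN 8, FILE 2 of 2 — the `v ∣ p` socket of T-T3CTL's ENDs)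

HONEST FRAMING (cell `b2b-bsdres-*`, team n1011, verbatim): prove what is provable now; shrink each
hard class to its core with data; no claim beyond stated classes. Research route; TOOL theorems
only — no definition, no named fact, nothing booked, no residual-map mark moved, no class closed.

## What

R. Greenberg, *Iwasawa theory for elliptic curves*, LNM 1716 (1999), Lemma 3.4 (p. 89): for `E/ℚ`
with good ordinary reduction at `p` and `v ∣ p`, `ker(H¹(ℚ_v, E[p^∞]) → H¹(ℚ_{v,∞}, E[p^∞]))` is
finite of order `#Ẽ(𝔽_p)(p)²`; in particular it VANISHES when `p ∤ #Ẽ(𝔽_p)` (non-anomalous), and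
then hypothesis (i) of Prop. 3.8 (p. 95) needs no further input. The tree has the FINITENESS
(`finite_localTowerKerPrimary_zero_of_ordinary`); this file proves the VANISHING, as an instance of
p12 GEN 8's T-T3B END `GoodModelLine.localTowerKerPrimary_zero_eq_bot_of_goodModel`
(`Additive/LocalTowerKernelAtPTwistedOrdinary`, stated for a good model with an ordinary point and a
MOVING element of `(ker κ)_v`) with: the good model = the minimal model itself (`C = 1`,
`W₀ = W_ℤ ⊗ 𝒪_w`, reduction map `red = localRed`, exactly cc-typer-2's `S2 → A239` instantiation in
`Greenberg1999/KummerImageGoodOrdinaryModel`), `hord` = `exists_zsmul_eq_zero_localRed_ne_zero`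
(`p ∤ a_p`), `hdiv₁`/`htor` = p07's (F4.b)/(F4.c), `hTfin`/`hu` = FILE 1
(`Iwasawa/GoodReductionFixedPointsTorsion`), and — the one new arithmetic step —

* `exists_zmod_cast_eq_of_pow_eq` — in a field of characteristic `p`, `a ^ p = a` forces `a ∈ 𝔽_p`
  (root count of `X^p − X`);
* `exists_mem_localSubgroup_localRed_smul_sub_ne_zero` — **`hmove` from NON-ANOMALY**: the
  arithmetic Frobenius `τ ∈ (ker κ)_v` fixing `μ_{p^∞}` (tree `exists_isArithFrobAt_forall_smul_eq`,
  `resGal_mem_kerSubgroup_of_forall_smul_rootOfUnity_eq`; `κ` cyclotomic) MOVES the ordinary point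
  `P ∈ E[p]`, `red P ≠ Õ`: otherwise `red P = red (τP)` has coordinates fixed by `x ↦ x^p`
  (`residueMap_pow_eq_of_reducePoint_smul_eq`), i.e. in `𝔽_p`, so `red P` comes from a point of
  ORDER `p` of `W_ℤ mod p` over `𝔽_p`, and `p ∣ #Ẽ(𝔽_p) = reductionPointCount W p` — anomalous;
* `localTowerKerPrimary_zero_eq_bot_of_goodOrdinary_nonAnomalous` — **THE END**: `v ∋ p`,
  `p ∤ Δ_E`, `p ∤ a_p`, `p ∤ #Ẽ(𝔽_p)`, `κ` cyclotomic ⟹ `W.localTowerKerPrimary κ (v.adicCompletion ℚ) 0 = ⊥`.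

Displayed hypotheses (referee-1 GEN 29): `hΔ` (good), `hord` (ordinary) AND `hna` (non-anomalous),
`hκ : κ.IsCyclotomic` (the Frobenius-in-`(ker κ)_v` device; over `ℚ` every `ℤ_p`-extension is
cyclotomic, not used). NOT claimed: anomalous primes (the kernel is non-zero there), `p ∣ Δ_E`.
Axioms standard.

References: [GreenbergLNM1716] §3 Lemma 3.4 (p. 89), Prop. 3.8 (p. 95), §2 p. 70;
[SilvermanAEC2009] VII.2.1, VII.3.1, V.2; cells/n1011/skel/T-GR34NA.md; p12 GEN 8's hand-over
(cells/n1011/INBOX.md 2026-08-21 20:37Z).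
-/

set_option autoImplicit false

noncomputable section

open scoped Classical NNReal Polynomial

universe u

open Polynomial NumberField IsDedekindDomain Field IsDedekindDomain.HeightOneSpectrum WeierstrassCurve
open Literature.NumberTheory.EllipticCurves Literature.NumberTheory.GaloisRepresentations
  Literature.NumberTheory.EllipticCurves.FormalGroupChart
  Summit.BirchSwinnertonDyer.Rank1Residual.X2.GreenbergVatsalReductionDatum
  Summit.BirchSwinnertonDyer.Rank1Residual.Additive

namespace Summit.BirchSwinnertonDyer.Rank1Residual.Iwasawa.GoodOrdinary

/-! ### §1 `a ^ p = a` in characteristic `p` -/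

/-- **The prime field is the fixed field of `x ↦ x ^ p`**: in a field `L` of characteristic `p`,
every `a` with `a ^ p = a` is the image of an element of `𝔽_p = ZMod p` (the `p` elements of `𝔽_p`
are roots of `X ^ p − X`, which has at most `p` roots). [folklore] -/
theorem exists_zmod_cast_eq_of_pow_eq {L : Type u} [Field L] {p : ℕ} [hp : Fact p.Prime] [CharP L p]
    {a : L} (ha : a ^ p = a) : ∃ i : ZMod p, ZMod.castHom (dvd_refl p) L i = a := by
  have hp1 : 1 < p := hp.out.one_lt
  have hf0 : (X ^ p - X : L[X]) ≠ 0 := FiniteField.X_pow_card_sub_X_ne_zero L hp1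
  have hdeg : (X ^ p - X : L[X]).natDegree = p := FiniteField.X_pow_card_sub_X_natDegree_eq L hp1
  have hinj : Function.Injective (ZMod.castHom (dvd_refl p) L) :=
    (ZMod.castHom (dvd_refl p) L).injective
  have hroot : ∀ b : L, b ^ p = b → b ∈ (X ^ p - X : L[X]).roots.toFinset := fun b hb ↦ by
    rw [Multiset.mem_toFinset, Polynomial.mem_roots hf0, Polynomial.IsRoot.def, eval_sub, eval_pow,
      eval_X, hb, sub_self]
  have hSsub : (Finset.univ : Finset (ZMod p)).image (ZMod.castHom (dvd_refl p) L) ⊆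
      (X ^ p - X : L[X]).roots.toFinset := by
    intro b hb
    obtain ⟨i, -, rfl⟩ := Finset.mem_image.mp hb
    exact hroot _ (by rw [← map_pow, ZMod.pow_card])
  have hle : (X ^ p - X : L[X]).roots.toFinset.card ≤
      ((Finset.univ : Finset (ZMod p)).image (ZMod.castHom (dvd_refl p) L)).card := by
    rw [Finset.card_image_of_injective _ hinj, Finset.card_univ, ZMod.card]
    calc (X ^ p - X : L[X]).roots.toFinset.card
        ≤ Multiset.card (X ^ p - X : L[X]).roots := Multiset.toFinset_card_le _
      _ ≤ (X ^ p - X : L[X]).natDegree := Polynomial.card_roots' _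
      _ = p := hdeg
  have heq := Finset.eq_of_subset_of_card_le hSsub hle
  have haS : a ∈ (Finset.univ : Finset (ZMod p)).image (ZMod.castHom (dvd_refl p) L) := by
    rw [heq]; exact hroot a ha
  obtain ⟨i, -, hi⟩ := Finset.mem_image.mp haS
  exact ⟨i, hi⟩

/-! ### §2 `hmove` from non-anomaly -/

section Local

variable (W : WeierstrassCurve ℚ) [W.IsElliptic] [W.IsGloballyMinimal] (p : ℕ) [hp : Fact p.Prime]
  {v : HeightOneSpectrum (𝓞 ℚ)}

/-- **A Frobenius of `(ker κ)_v` MOVES the ordinary `p`-torsion point at a NON-ANOMALOUS good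
ordinary `v ∋ p`.** For `κ` cyclotomic there is an arithmetic Frobenius `τ ∈ (ker κ)_v`
(`exists_isArithFrobAt_forall_smul_eq` + `resGal_mem_kerSubgroup_of_forall_smul_rootOfUnity_eq`);
let `P ∈ E[p]` be the ordinary point (`red P ≠ Õ`, `exists_zsmul_eq_zero_localRed_ne_zero`). If
`red (τP − P) = Õ`, the coordinates of `red P` are fixed by `x ↦ x^p`
(`residueMap_pow_eq_of_reducePoint_smul_eq`, `#k_v = p`), hence lie in `𝔽_p`
(`exists_zmod_cast_eq_of_pow_eq`), so `red P` is the image of a point of `W_ℤ mod p` over `𝔽_p` of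
order `p` under the injective map `Ẽ(𝔽_p) → Ẽ(k̄_v)`, and `p ∣ #Ẽ(𝔽_p) = reductionPointCount W p`,
contradicting non-anomaly. Greenberg, LNM 1716, Lemma 3.4 (p. 89: the factor `#Ẽ(𝔽_p)(p)`).
[cite: GreenbergLNM1716, §3 Lemma 3.4 (p. 89)] -/
theorem exists_mem_localSubgroup_localRed_smul_sub_ne_zero (hpv : ((p : ℕ) : 𝓞 ℚ) ∈ v.asIdeal)
    (hΔ : ¬ (p : ℤ) ∣ minimalDiscriminantInt W) (hord : ¬ (p : ℤ) ∣ W.frobeniusTrace p)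
    (hna : ¬ p ∣ W.reductionPointCount p) (κ : ZpExtension ℚ p) (hκ : κ.IsCyclotomic) :
    ∃ σ ∈ localSubgroup κ.kerSubgroup (v.adicCompletion ℚ),
      ∃ P : localPoints W (v.adicCompletion ℚ), p • P = 0 ∧
        localRed W p hpv hΔ (σ • P - P) ≠ 0 := by
  -- notation and the standard set-up of the ordinary files
  have hw := specVal_spec v
  have hvO : (specVal v).Integers (specVal v).valuationSubring :=
    Valuation.valuationSubring.integers (specVal v)
  have hΔu : IsUnit ((integralModelInt W).map (algebraMap ℤ ↥(specVal v).valuationSubring)).Δ :=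
    isUnit_Δ_localIntModel W hpv hw hΔ
  have hMK : ((integralModelInt W).map (algebraMap ℤ ↥(specVal v).valuationSubring)).baseChange
      (AlgebraicClosure (v.adicCompletion ℚ)) = W.baseChange (AlgebraicClosure (v.adicCompletion ℚ)) :=
    localIntModel_baseChange W (specVal v).valuationSubring
  haveI hV : (W.baseChange (AlgebraicClosure (v.adicCompletion ℚ))).IsIntegral (specVal v).integer :=
    ⟨⟨(integralModelInt W).map (algebraMap ℤ ↥(specVal v).integer),
      W.baseChange_eq_localIntModel_integer_baseChange⟩⟩
  obtain ⟨𝔐, h𝔐⟩ := v.localPrimesAbove_nonempty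
  have hϖ : Irreducible ((p : ℕ) : v.adicCompletionIntegers ℚ) :=
    irreducible_natCast_adicCompletionIntegers_rat hpv
  obtain ⟨τ, hτ, hτfix⟩ := exists_isArithFrobAt_forall_smul_eq hw h𝔐 hpv hϖ
  have hτHi : τ ∈ localSubgroup κ.kerSubgroup (v.adicCompletion ℚ) :=
    (mem_localSubgroup_iff _ _ τ).mpr (resGal_mem_kerSubgroup_of_forall_smul_rootOfUnity_eq hκ hτfix)
  obtain ⟨r, hr, -, hrF⟩ := exists_residueMap hw h𝔐
  -- `q = p`
  have hq : Nat.card (IsLocalRing.ResidueField (v.adicCompletionIntegers ℚ)) = p := by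
    rw [natCard_residueField_adicCompletionIntegers v,
      Rat.HeightOneSpectrum.primesEquiv_eq_of_natCast_mem v hp.out hpv]
  -- the ordinary point
  obtain ⟨P, hpP, hredP⟩ := W.exists_zsmul_eq_zero_localRed_ne_zero hw hΔu (localRed W p hpv hΔ)
    (localRed_apply W p hpv hΔ) hpv hΔ hord
  refine ⟨τ, hτHi, P, by rw [← natCast_zsmul]; exact hpP, fun hcon ↦ hna ?_⟩
  have heq0 : localRed W p hpv hΔ (τ • P) = localRed W p hpv hΔ P := by
    rwa [map_sub, sub_eq_zero] at hcon
  -- `P = (x, y)` with `x` integral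
  obtain ⟨x, y, h, hPxy⟩ : ∃ x y h, P = Affine.Point.some x y h := by
    have hP0 : P ≠ 0 := fun h0 ↦ hredP (by rw [h0, map_zero])
    revert hP0
    change ∀ _ : (show (W.baseChange (AlgebraicClosure (v.adicCompletion ℚ))).toAffine.Point from P) ≠ 0, _
    rcases P with _ | ⟨x, y, h⟩
    · intro h0; exact absurd Affine.Point.zero_def h0.symm
    · intro; exact ⟨x, y, h, rfl⟩
  have hx : specVal v x ≤ 1 := by
    by_contra hx
    apply hredP
    rw [hPxy]
    exact (W.localRed_eq_zero_iff_mem_kernel hΔu (localRed W p hpv hΔ) (localRed_apply W p hpv hΔ)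
      (Affine.Point.some x y h)).mpr ((some_mem_kernel_iff (w := specVal v) h).mpr (not_le.mp hx))
  -- the Frobenius congruence: the coordinates of `red P` are fixed by `x ↦ x ^ p`
  have heq := heq0
  rw [localRed_apply W p hpv hΔ, localRed_apply W p hpv hΔ] at heq
  obtain ⟨hy, hxq, hyq⟩ := residueMap_pow_eq_of_reducePoint_smul_eq hw hr hrF hτ hΔu hMK hx hPxy heq
  rw [hq] at hxq hyq
  -- the residue field `k̄` of characteristic `p`, and the prime field inside it
  set k := IsLocalRing.ResidueField (v.adicCompletionIntegers ℚ) with hk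
  haveI : Finite k := finite_residueField_adicCompletionIntegers ℚ v
  haveI : Fintype k := Fintype.ofFinite k
  haveI hchark : CharP (AlgebraicClosure k) p := by
    refine (CharP.charP_iff_prime_eq_zero hp.out).mpr ?_
    have h1 : ((Nat.card k : ℕ) : AlgebraicClosure k) = 0 := by
      rw [Nat.card_eq_fintype_card, ← map_natCast (algebraMap k (AlgebraicClosure k)),
        FiniteField.cast_card_eq_zero, map_zero]
    rwa [hq] at h1
  obtain ⟨i, hi⟩ := exists_zmod_cast_eq_of_pow_eq (L := AlgebraicClosure k) hxq
  obtain ⟨j, hj⟩ := exists_zmod_cast_eq_of_pow_eq (L := AlgebraicClosure k) hyq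
  -- the residue map factors through the residue field `k_w` of `𝒪_w`
  have hker : ∀ a ∈ IsLocalRing.maximalIdeal ((specVal v).valuationSubring), r a = 0 := by
    intro a ha
    rw [IsLocalRing.mem_maximalIdeal, mem_nonunits_iff, hvO.isUnit_iff_valuation_eq_one] at ha
    exact (hr a).mpr (lt_of_le_of_ne ((Valuation.mem_valuationSubring_iff (specVal v) _).mp a.2) ha)
  let rt : IsLocalRing.ResidueField ((specVal v).valuationSubring) →+* AlgebraicClosure k :=
    Ideal.Quotient.lift (IsLocalRing.maximalIdeal ((specVal v).valuationSubring)) r hker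
  have hrt : ∀ a, rt (IsLocalRing.residue ((specVal v).valuationSubring) a) = r a := fun a ↦
    Ideal.Quotient.lift_mk _ _ _
  -- the reduced point `R = red P = (x̄, ȳ)`, of order `p`
  obtain ⟨hy', hns, eR⟩ := reducePoint_congrEquiv_some_of_val_le_one hΔu hMK x y h hx
  set R := localRed W p hpv hΔ P with hRdef
  have hR : R = Affine.Point.some (IsLocalRing.residue ((specVal v).valuationSubring) ⟨x, hx⟩)
      (IsLocalRing.residue ((specVal v).valuationSubring) ⟨y, hy'⟩) hns := by
    rw [hRdef, hPxy, localRed_apply]; exact eR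
  have hRord : addOrderOf R = p := by
    refine addOrderOf_eq_prime_iff.mpr ⟨?_, hredP⟩
    rw [hRdef, ← map_nsmul, ← natCast_zsmul, hpP, map_zero]
  -- the curve `W_ℤ mod p` over `𝔽_p`, and `k_w`, `k̄` as `𝔽_p`-algebras
  haveI hcharw : CharP (IsLocalRing.ResidueField ((specVal v).valuationSubring)) p :=
    GoodModelLine.charP_residueField_specVal p hpv
  letI algw : Algebra (ZMod p) (IsLocalRing.ResidueField ((specVal v).valuationSubring)) :=
    ZMod.algebra _ p
  letI algk : Algebra (ZMod p) (AlgebraicClosure k) := ZMod.algebra _ p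
  set Wp : WeierstrassCurve (ZMod p) := (integralModelInt W).map (Int.castRingHom (ZMod p)) with hWp
  have hcurve : ((integralModelInt W).map (algebraMap ℤ ↥(specVal v).valuationSubring)).map
      (IsLocalRing.residue ((specVal v).valuationSubring)) =
      Wp.baseChange (IsLocalRing.ResidueField ((specVal v).valuationSubring)) := by
    rw [hWp, WeierstrassCurve.map_map, WeierstrassCurve.baseChange, WeierstrassCurve.map_map]
    congr 1
    exact Subsingleton.elim _ _
  -- `rt` as an `𝔽_p`-algebra map, and the transport of `R` to `W_ℤ ⊗ k̄`
  let rt' : IsLocalRing.ResidueField ((specVal v).valuationSubring) →ₐ[ZMod p] AlgebraicClosure k :=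
    { rt with
      commutes' := fun c ↦ congrFun (congrArg DFunLike.coe (Subsingleton.elim
        (rt.comp (algebraMap (ZMod p) (IsLocalRing.ResidueField ((specVal v).valuationSubring))))
        (algebraMap (ZMod p) (AlgebraicClosure k)))) c }
  have hrt' : ∀ a, rt' a = rt a := fun _ ↦ rfl
  have hψ₁ : Function.Injective (Affine.Point.map (W' := Wp) rt') := Affine.Point.map_injective _
  set R₁ := Affine.Point.map (W' := Wp) rt' (Affine.Point.congrEquiv hcurve R) with hR₁def
  have hR₁ord : addOrderOf R₁ = p := by
    rw [hR₁def, addOrderOf_injective _ hψ₁, AddEquiv.addOrderOf_eq, hRord]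
  obtain ⟨h₁, e₁⟩ : ∃ h₁, R₁ = Affine.Point.some (rt (IsLocalRing.residue
      ((specVal v).valuationSubring) ⟨x, hx⟩)) (rt (IsLocalRing.residue ((specVal v).valuationSubring)
      ⟨y, hy'⟩)) h₁ :=
    ⟨_, by rw [hR₁def, hR, Affine.Point.congrEquiv_some, Affine.Point.map_some]; rfl⟩
  have hxi : rt (IsLocalRing.residue ((specVal v).valuationSubring) ⟨x, hx⟩) =
      algebraMap (ZMod p) (AlgebraicClosure k) i := (hrt _).trans hi.symm
  have hyj : rt (IsLocalRing.residue ((specVal v).valuationSubring) ⟨y, hy'⟩) =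
      algebraMap (ZMod p) (AlgebraicClosure k) j := (hrt _).trans hj.symm
  -- the point over `𝔽_p` and the injective map `Ẽ(𝔽_p) → Ẽ(k̄)`
  have hιinj : Function.Injective (Algebra.ofId (ZMod p) (AlgebraicClosure k)) :=
    (algebraMap (ZMod p) (AlgebraicClosure k)).injective
  have h₁' : (Wp.baseChange (AlgebraicClosure k)).toAffine.Nonsingular
      (Algebra.ofId (ZMod p) (AlgebraicClosure k) i) (Algebra.ofId (ZMod p) (AlgebraicClosure k) j) := by
    rw [Algebra.ofId_apply, Algebra.ofId_apply, ← hxi, ← hyj]; exact h₁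
  have h₀ : (Wp.baseChange (ZMod p)).toAffine.Nonsingular i j :=
    (Wp.toAffine.baseChange_nonsingular (f := Algebra.ofId (ZMod p) (AlgebraicClosure k)) hιinj i j).mp
      h₁'
  have hψ₀ : Function.Injective (Affine.Point.map (W' := Wp) (Algebra.ofId (ZMod p)
      (AlgebraicClosure k))) := Affine.Point.map_injective _
  have hR₀ : Affine.Point.map (W' := Wp) (Algebra.ofId (ZMod p) (AlgebraicClosure k))
      (Affine.Point.some i j h₀) = R₁ := by
    rw [e₁, Affine.Point.map_some]
    exact point_some_congr hxi.symm hyj.symm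
  have hR₀ord : addOrderOf (Affine.Point.some i j h₀ : (Wp.baseChange (ZMod p)).toAffine.Point) = p := by
    rw [← addOrderOf_injective _ hψ₀, hR₀, hR₁ord]
  -- `p ∣ #Ẽ(𝔽_p)`
  have e0 : Wp.baseChange (ZMod p) = Wp := by
    rw [WeierstrassCurve.baseChange, Algebra.algebraMap_self, WeierstrassCurve.map_id]
  have hdvd := addOrderOf_dvd_natCard (Affine.Point.some i j h₀ : (Wp.baseChange (ZMod p)).toAffine.Point)
  rw [hR₀ord, Nat.card_congr (Affine.Point.congrEquiv e0).toEquiv] at hdvd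
  rw [reductionPointCount, ← hWp]
  exact hdvd

/-! ### §3 THE END: Greenberg's Lemma 3.4 at `n = 0`, vanishing case -/

/-- **Greenberg's Lemma 3.4 at `n = 0` in its vanishing case — the `v ∣ p` socket of T-T3CTL at a
GOOD ORDINARY NON-ANOMALOUS prime.** For `E = W/ℚ` elliptic and globally minimal, `p` prime,
`v ∋ p` with `p ∤ Δ_E` (good), `p ∤ a_p` (ordinary) and `p ∤ #Ẽ(𝔽_p) = reductionPointCount W p`
(non-anomalous), and the cyclotomic `ℤ_p`-extension `κ`:
`W.localTowerKerPrimary κ (v.adicCompletion ℚ) 0 = ⊥`, i.e.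
`ker (H¹(ℚ_v, E(K̄_v)) → H¹(ℚ_v ℚ_∞, E(K̄_v)))[p^∞] = 0` — Greenberg's `#ker(r_v) = #Ẽ(𝔽_p)(p)² = 1`.
Proof: p12's T-T3B END `GoodModelLine.localTowerKerPrimary_zero_eq_bot_of_goodModel` for the
minimal model as its own good model (`C = 1`, `W₀ = W_ℤ ⊗ 𝒪_w`, `red = localRed`; cc-typer-2's
instantiation), with `hord` = `exists_zsmul_eq_zero_localRed_ne_zero`, `hdiv₁`/`htor` = p07's
(F4.b)/(F4.c), `hTfin`/`hu` = FILE 1 (`GoodFixedLevel.finite_fixed_primary_localRed_ker`,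
`exists_fixed_localRed_ker_not_pdivisible`), `hmove` = §2. Greenberg, LNM 1716, Lemma 3.4 (p. 89)
and Prop. 3.8 (i) (p. 95). [cite: GreenbergLNM1716, §3 Lemma 3.4 (p. 89) and Prop. 3.8 (p. 95)] -/
theorem localTowerKerPrimary_zero_eq_bot_of_goodOrdinary_nonAnomalous
    (hpv : ((p : ℕ) : 𝓞 ℚ) ∈ v.asIdeal) (hΔ : ¬ (p : ℤ) ∣ minimalDiscriminantInt W)
    (hord : ¬ (p : ℤ) ∣ W.frobeniusTrace p) (hna : ¬ p ∣ W.reductionPointCount p)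
    (κ : ZpExtension ℚ p) (hκ : κ.IsCyclotomic) :
    W.localTowerKerPrimary κ (v.adicCompletion ℚ) 0 = ⊥ := by
  -- the F-A2 datum of the minimal model (`C = 1`), as in cc-typer-2's `S2 → A239` derivation
  have hΔu : IsUnit ((integralModelInt W).map (algebraMap ℤ ↥(specVal v).valuationSubring)).Δ :=
    isUnit_Δ_localIntModel W hpv (specVal_spec v) hΔ
  let W₀ : WeierstrassCurve (specVal v).integer :=
    (integralModelInt W).map (algebraMap ℤ ↥(specVal v).valuationSubring)
  have hΔ' : IsUnit W₀.Δ := hΔu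
  have e₁ : W₀.baseChange (AlgebraicClosure (v.adicCompletion ℚ)) =
      W.baseChange (AlgebraicClosure (v.adicCompletion ℚ)) :=
    localIntModel_baseChange W (specVal v).valuationSubring
  have hW₀ : (1 : VariableChange (AlgebraicClosure (v.adicCompletion ℚ))) •
      (W.baseChange (v.adicCompletion ℚ)).baseChange (AlgebraicClosure (v.adicCompletion ℚ)) =
        W₀.baseChange (AlgebraicClosure (v.adicCompletion ℚ)) := by
    rw [one_smul, baseChange_baseChange_adicCompletion, e₁]
  have hred : ∀ P, localRed W p hpv hΔ P = goodReductionHom W₀ (Valuation.integer.integers (specVal v))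
      hΔ' (Affine.Point.congrEquiv hW₀ (VariableChange.pointEquiv _ 1
        (Affine.Point.congrEquiv (baseChange_baseChange_adicCompletion W v).symm P))) := by
    intro P
    rw [localRed_apply, goodReductionHom_apply]
    congr 1
    change (W.baseChange (AlgebraicClosure (v.adicCompletion ℚ))).toAffine.Point at P
    rcases P with _ | ⟨x, y, hP⟩
    · simp only [← Affine.Point.zero_def, map_zero]
      rfl
    · simp only [Affine.Point.congrEquiv_some, VariableChange.pointEquiv_some]
      exact point_some_congr (Literature.NumberTheory.EllipticCurves.toX_one x).symm
        (Literature.NumberTheory.EllipticCurves.toY_one x y).symm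
  have hord' : ∃ P : (W₀.baseChange (AlgebraicClosure (v.adicCompletion ℚ))).toAffine.Point,
      (p : ℤ) • P = 0 ∧ goodReductionHom W₀ (Valuation.integer.integers (specVal v)) hΔ' P ≠ 0 := by
    obtain ⟨P, hP, hne⟩ := W.exists_zsmul_eq_zero_localRed_ne_zero (specVal_spec v) hΔu
      (localRed W p hpv hΔ) (localRed_apply W p hpv hΔ) hpv hΔ hord
    refine ⟨Affine.Point.congrEquiv e₁.symm P, ?_, ?_⟩
    · rw [← map_zsmul]
      exact (congr_arg _ hP).trans (map_zero _)
    · intro h0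
      apply hne
      rw [localRed_apply]
      exact h0
  exact GoodModelLine.localTowerKerPrimary_zero_eq_bot_of_goodModel W p hW₀ hΔ' (localRed W p hpv hΔ)
    hred hpv hord' κ
    (GoodModelLine.exists_red_eq_zero_and_nsmul_eq W p hW₀ hΔ' (localRed W p hpv hΔ) hred hpv hord')
    (fun P ↦ GoodModelLine.exists_nsmul_red_eq_zero W (localRed W p hpv hΔ) P)
    (GoodFixedLevel.finite_fixed_primary_localRed_ker W p hpv hΔ)
    (GoodFixedLevel.exists_fixed_localRed_ker_not_pdivisible W p hpv hΔ)
    (exists_mem_localSubgroup_localRed_smul_sub_ne_zero W p hpv hΔ hord hna κ hκ)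

end Local

end Summit.BirchSwinnertonDyer.Rank1Residual.Iwasawa.GoodOrdinary

end
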